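import Literature.MathematicalPhysics.QuantumFieldTheory.Balaban1983to89.B9Thm312WholeBlocksNbr
import Literature.MathematicalPhysics.QuantumFieldTheory.Balaban1983to89.B9RWSums344InputFam

/-!
# `Balaban1983to89.B9Thm312WholeDir` — [B9] Theorem 3.12 (p. 423): the MIXED second-order member ∇_UA∇\*_U of the Sect.-D propagators
# A ∈ {G, G₁} ON PRINT'S DIRECTION-PAIR FAMILY ∇_{U,ν}A∇\*_{U,μ} — Theorem 3.3 for G₀ and the perturbation step stated PER DIRECTION
# (schemas of printed shape), and the (3.44)∕(3.45)∕(3.46)₃ majorants of the packaged family at one member and one configuration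

T. Bałaban, *Propagators for lattice gauge theories in a background field*, Commun. Math. Phys. **99** (1985) 389–434
[`Balaban1985BackgroundPropagators`, "B9"]; [4] = T. Bałaban, *Propagators and renormalization transformations for lattice
gauge theories. II*, Commun. Math. Phys. **96** (1984) 223–250 [`Balaban1984PropagatorsII`].

statement-level skeleton of published theorems with citation tags; proofs where landed; nothing here is a claim about the
Yang–Mills mass gap

THE PRINTED LOCI.  (3.39) p. 397: *"|∇_UG(x,x′)| = max_μ |(∇_UG)(⟨x, x+μ⟩, x′)|, |∇_UG∇\*_U(b,b′)| = max_{μ,ν} …"* — every norm of a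
two-direction quantity runs over ALL direction pairs; (3.44)–(3.45) p. 398 (*"|(∇_UG(U)∇\*_Uλ)(x)| ≦ B′₀(ε)e^{−δ₀d(y,y′)}(‖λ‖_ε + |λ|)"*,
*"‖ζ∇_UG(U)∇\*_Uλ‖_β ≦ …"*); (3.46) p. 398 (the member *"‖h∇_UG(U)∇\*_Uλ‖"*); Theorem 3.3 p. 399 (G₀ = G(U) *"satisfies the inequalities
(3.42)–(3.47)"*); (3.130) p. 421 and p. 421's placement rule (*"One of the three derivatives there has to be applied either to an expression
on the right, or on the left, of Δ′_π"*); p. 422 (*"This inequality [(3.131)] and Theorem 3.3 for G₀ imply a convergence of the series (3.130),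
for α₀ sufficiently small, in all norms appearing on the left-hand sides of the inequalities (3.42)–(3.47)"*); p. 423 (the displayed Hölder
pattern for (3.138), *"constants O(1) we get depend only on B₀(ε)"*); p. 398 (the scale-transfer remark); [4] (2.51)–(2.54) p. 232, Lemma
2.1 (2.60)–(2.61) p. 234.

WHY THIS FILE (successor work of the same seat; located point (O4′) of seats n06-k ∕ n06-d, pub-ymgap bus 2026-08-27).  The row-20 leaf of
record `…B9Thm312WholeLeafCompleteNbrRec.thm312Printed_completeNbrRec` reads the record's third L² member `K.l2 3` and the (3.44)∕(3.45)
members `K.e4`, `K.h2` through the ONE-SLOT composite `D U ∘ₗ (A ∘ₗ Dstar U)` of the bundled letters ∇_U : 𝔩(X) → 𝔩(Y), ∇\*_U : 𝔩(Y) →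
𝔩(X).  At the record's coordinate pins the bundled letters compose slice-wise (`B9CoReadingCoords.coordOpK_comp`), so that composite carries
only the DIAGONAL pairs ν = μ while def-Y's `kernelFamilyB.l2 3 ∕ .e4 ∕ .h2` take `⨆ ν, ⨆ μ`: the displayed co-reading binders `hl2N`∣₃ and
`hIN` of that leaf can never be discharged there.  THIS FILE carries print's p. 422 sentence to the DIRECTION-PAIR FAMILY exactly as the
sibling leaves already do for the two other second-order members (`…BlocksNbr.l2bd_family3∕5_of_step`): with the direction letters
`Dd U ν` = ∇_{U,ν}, `Dds U μ` = ∇\*_{U,μ} (operators on the G-lattice X, the letters of `…BlocksNbr.Thm33G0L2P`) the mixed member is the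
family `q ↦ ∇_{U,q.1} ∘ A ∘ ∇\*_{U,q.2}` packaged into X × (P × P) by n06-k's `familyOp` (block map `blk ∘ Prod.fst`), read through input
Hölder norms `bHX ε` on X-functions and the X-probes Φ^X_β SLICED over the family (`B9RWSums344InputFam.sliceProbe`) — the species of
n06-k's v4 face `B9RWSumsDefinitePinsPairM.rows131819_definite_geo9Y_pairM` (`hl3`, `hIR`).
* §1 HYPOTHESIS SCHEMAS of printed shape (Prop structures; nothing asserted), the direction-indexed twins of the sibling schemas:
  `Thm33G0Dir` = THEOREM 3.3 FOR G₀ — the one-slot (3.43) probe members (verbatim `…Classes.Thm33G0H.h43L ∕ .h43R`, still read one-slot: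
  (3.43) is first order) and, PER DIRECTION ∕ PAIR, (3.42)₂ of ∇_νG₀ (`e1d`), the Φ^X_β-probe of ∇_νG₀ (`h43d`), (3.44) of ∇_νG₀∇\*_μ from
  `bHX ε` (`h44m`), (3.45) of Φ^X_β∘∇_νG₀∇\*_μ from `bHX (β+ε)` (`h45m`); `Thm33G0L2M` = `Thm33G0L2P` + the block-L² lines of ∇_νG₀,
  G₀∇\*_μ, ∇_νG₀∇\*_μ (`l1d l2d l4m`); `StepDir` = THE PERTURBATION STEP — the one-slot probe members (verbatim `…Classes.StepH.pY ∕ pY1 ∕ pX ∕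
  pX1`) and, PER DIRECTION, the derivative ∇_νG₀T : 𝔠⁽²⁾ → 𝔠⁽¹⁾ (`sDd ∕ sDd1`, species of `LeftStep.stepD`), its probe Φ^X_β∘∇_νG₀∘T from
  𝔠^{(−2)} (`pXd ∕ pXd1`), and T∘G₀∇\*_μ out of `bHX ε` (`tDd ∕ tDd1`, species of `StepH.tD`) — their derivations from (3.131), (3.137),
  Theorems 3.1–3.3 and (3.49) are the located gap G-B9-16 (declared, not typed), exactly as for the one-slot schemas they refine.
  NO letter-about-letters is posited (a one-slot majorant cannot dominate an off-diagonal pair; the direction members are stated for G₀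
  directly, as print's Theorem 3.3 states them, (3.39)).
* §2 ONE MEMBER, ONE U, A with (Δ_a − T)A = I (T = Δ′_π or Δ′_π + Δ⁽²⁾_π): per pair the sibling theorems apply VERBATIM with the letters
  E := ∇_ν, F := ∇\*_μ on the X-lattice (`B9Thm312WholeLeft.entry1_of_stepD`, `B9Thm312WholeHolder.probe43L_cNormR ∕ input44_of_step ∕
  input45_of_step`, r1-g6 `B9SectDL2Decay.thm312_entry_l2`); this file packages them over P × P: ★ `l2bd_mixed_of_step` (per pair) and
  ★ `l2bd_mixedFamily_of_step` (`blockBd_familyOp`, constant √|P × P|·K₄, K₄ = B₂ + B₂θ₂B₂(1 − B₂θ₂c²)⁻¹c², NO scale transfer: printed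
  weight 1 on both sides), ★ `input44_family_of_step` (`hasMaj_familyOp'`, no |P| factor: sup sizes), ★ `input45_family_of_step`
  (`sliceProbe_comp_familyOp` + `hasMaj_familyOp'`).
The typed blocks and the leaf are the sequels `…B9Thm312WholeBlocksPairM`, `…B9Thm312WholeLeafCompletePairM`.

HONEST SCOPE.  Nothing of [B9] or [4] is asserted: Theorem 3.3 for G₀ per direction, the step majorants per direction, [4] Lemma 2.1 and
the scale transfer are HYPOTHESES of printed shape; the content is print's bookkeeping (one resolvent identity, one composition, one
scale transfer per member, one packaging over the pairs), kernel-checked.  NOT a node discharge, NOT summit progress; count-neutral; one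
finite lattice at a time; nothing continuum, nothing about the mass gap.  Cell `pub-ymgap` (HUMAN RULING D-0062), Track A node N06 [B9],
N06-ASSIGNMENT v1 rows 20–21 (bundle F7), seat `pub-ymgap-dag-n06-l` (g6), 2026-08-27.
-/

namespace Literature.MathematicalPhysics.QuantumFieldTheory.Balaban1983to89.B9Thm312WholeDir

open Literature.MathematicalPhysics.QuantumFieldTheory.Balaban1983to89
open Finset B6RandomWalk B6RandomWalkHom B9Thm34Ext B9Thm37Glue B9Thm37GlueCor36 B11SectG B9SectDSup B9SectDL2Decay
open B9Thm37AllNorms B9Thm37AllNormsInstances B9FromB6 B9Thm312Whole B9Thm312WholeLeaf B9Thm312WholeLeft B9RWSums343Holder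
open B9Ineq347 B9Thm312WholeClasses B9Thm312WholeHolder B9Thm312WholeL2 B9Thm312WholeBlocksNbr B9RWSums346SecondDiff
open B9RWSums344InputFam

noncomputable section

/-! ## §1 The hypothesis schemas: Theorem 3.3 for G₀ and the perturbation step, direction-indexed members -/

section Schemas

variable {g : B9.Geometry} {B : B9.Backgrounds} {X Y Z W PX PY P : Type}
variable [Fintype X] [Fintype Y] [Fintype PX] [Fintype PY] [Fintype g.Site]

/-- **THEOREM 3.3 FOR G₀ AT THE CONFIGURATION U — THE HÖLDER PROBE MEMBERS AND THE DIRECTION-INDEXED MEMBERS** (p. 399: G₀ = G(U)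
*"satisfies the inequalities (3.42)–(3.47)"*; (3.39) p. 397: the norms run over all directions μ and all pairs μ, ν), read through
n06-k's probe letters `𝔭` ((3.40)), the direction letters `Dd U ν` = ∇_{U,ν}, `Dds U μ` = ∇\*_{U,μ} on the G-lattice X and the input
Hölder norms `bHX ε` of X-functions (block-norm letters): `h43L β` ∕ `h43R β` — the (3.43) members ‖ζ∇_UG₀λ‖_β, ‖ζG₀∇\*_Uλ‖_β as the
probe majorants of Φ^Y_β∘∇_U∘G₀ and Φ^X_β∘G₀∘∇\*_U (verbatim `…Classes.Thm33G0H.h43L ∕ .h43R`; first-order members, bundled letters);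
`e1d ν` — (3.42)₂ for the component ∇_{U,ν}G₀ : 𝔩(X) → 𝔩(X), majorant B₀Lʲη·e^{−δ₀d}; `h43d ν β` — the Φ^X_β-probe of ∇_{U,ν}G₀, majorant
B_h(β)(Lʲη)^{1−β}e^{−δ₀d}; `h44m q ε` — (3.44) for ∇_{U,q.1}G₀∇\*_{U,q.2} read from `bHX ε` into the sharp blocks of X, B_i(ε)e^{−δ₀d};
`h45m q ε β` — (3.45) for Φ^X_β∘∇_{U,q.1}G₀∇\*_{U,q.2} from `bHX (β+ε)` into the probe blocks, B_i(ε,β)(Lʲη)^{−β}e^{−δ₀d}.  A HYPOTHESIS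
SCHEMA (Theorem 3.3 is the leaf `t33` of the knit, not asserted here).
[cite: Balaban1985BackgroundPropagators, Thm 3.3 p.399 + (3.42)–(3.45) p.398 + (3.39)–(3.40) p.397] -/
structure Thm33G0Dir (𝔬 : Ops g B X Y Z W) (𝔭 : HolderProbes g B X Y PX PY) (Dd Dds : B.Cfg → P → Module.End ℝ (X → ℝ))
    (R₀ : ℝ) (H₀ : Prop) (bHX : ℝ → BlockNorm (toB6 g R₀ H₀) (X → ℝ)) (B₀ : ℝ) (Bh Bi : ℝ → ℝ) (Bi2 : ℝ → ℝ → ℝ) (δ₀ : ℝ)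
    (U : B.Cfg) : Prop where
  h43L : ∀ β : ℝ, 0 ≤ β → β < 1 → HasMajorantHom (g := toB6 g R₀ H₀) 𝔬.blk 𝔭.blkPY (𝔭.ΦY U β ∘ₗ (𝔬.D U ∘ₗ 𝔬.G0 U))
    (fun (a b : g.Site) => Bh β * g.len a ^ (1 - β) * Real.exp (-(δ₀ * g.dist a b)))
  h43R : ∀ β : ℝ, 0 ≤ β → β < 1 → HasMajorantHom (g := toB6 g R₀ H₀) 𝔬.blkY 𝔭.blkPX (𝔭.ΦX U β ∘ₗ (𝔬.G0 U ∘ₗ 𝔬.Dstar U))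
    (fun (a b : g.Site) => Bh β * g.len a ^ (1 - β) * Real.exp (-(δ₀ * g.dist a b)))
  e1d : ∀ ν : P, HasMajorantHom (g := toB6 g R₀ H₀) 𝔬.blk 𝔬.blk (Dd U ν ∘ₗ 𝔬.G0 U)
    (fun (a b : g.Site) => B₀ * g.len a * Real.exp (-(δ₀ * g.dist a b)))
  h43d : ∀ (ν : P) (β : ℝ), 0 ≤ β → β < 1 →
    HasMajorantHom (g := toB6 g R₀ H₀) 𝔬.blk 𝔭.blkPX (𝔭.ΦX U β ∘ₗ (Dd U ν ∘ₗ 𝔬.G0 U))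
      (fun (a b : g.Site) => Bh β * g.len a ^ (1 - β) * Real.exp (-(δ₀ * g.dist a b)))
  h44m : ∀ (q : P × P) (ε : ℝ), 0 < ε → ε ≤ 1 →
    HasMaj (bHX ε) (BlockNorm.ofBlocks (toB6 g R₀ H₀) 𝔬.blk) (Dd U q.1 ∘ₗ (𝔬.G0 U ∘ₗ Dds U q.2))
      (fun (a b : g.Site) => Bi ε * Real.exp (-(δ₀ * g.dist a b)))
  h45m : ∀ (q : P × P) (ε β : ℝ), 0 < ε → ε ≤ 1 → 0 ≤ β → β < 1 →
    HasMaj (bHX (β + ε)) (BlockNorm.ofBlocks (toB6 g R₀ H₀) 𝔭.blkPX) (𝔭.ΦX U β ∘ₗ (Dd U q.1 ∘ₗ (𝔬.G0 U ∘ₗ Dds U q.2)))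
      (fun (a b : g.Site) => Bi2 ε β * g.len a ^ (-β) * Real.exp (-(δ₀ * g.dist a b)))

/-- **THEOREM 3.3, THE L² MEMBERS (3.46), FOR G₀ AT U — WITH THE DIRECTION-INDEXED FIRST-ORDER LINES AND THE MIXED LINE PER PAIR**:
`…BlocksNbr.Thm33G0L2P` (lines 0, 1, 2, 4 one-slot; ∇_ν∇_μG₀ and G₀∇\*_ν∇\*_μ per pair) extended by `l1d ν` — ∇_{U,ν}G₀ with B·L^{j′}η
((3.46)₁ at the input scale, as `l1`), `l2d μ` — G₀∇\*_{U,μ} with B·Lʲη (as `l2`), `l4m q` — ∇_{U,q.1}G₀∇\*_{U,q.2} with B ((3.46)₄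
verbatim, per pair; (3.39) *"max_{μ,ν}"*).  A HYPOTHESIS SCHEMA; nothing asserted.
[cite: Balaban1985BackgroundPropagators, Thm 3.3 p.399 + (3.46) p.398 + (3.39) p.397 + p.398 (remark after (3.47))] -/
structure Thm33G0L2M (𝔬 : Ops g B X Y Z W) (Dd Dds : B.Cfg → P → Module.End ℝ (X → ℝ)) (R₀ : ℝ) (H₀ : Prop) (B₂ δ₁ : ℝ)
    (U : B.Cfg) : Prop extends Thm33G0L2P 𝔬 Dd Dds R₀ H₀ B₂ δ₁ U where
  l1d : ∀ ν : P, BlockBd (g := toB6 g R₀ H₀) 𝔬.blk 𝔬.blk (Dd U ν ∘ₗ 𝔬.G0 U)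
    (fun (y y' : g.Site) => B₂ * g.len y' * Real.exp (-(δ₁ * g.dist y y')))
  l2d : ∀ μ : P, BlockBd (g := toB6 g R₀ H₀) 𝔬.blk 𝔬.blk (𝔬.G0 U ∘ₗ Dds U μ)
    (fun (y y' : g.Site) => B₂ * g.len y * Real.exp (-(δ₁ * g.dist y y')))
  l4m : ∀ q : P × P, BlockBd (g := toB6 g R₀ H₀) 𝔬.blk 𝔬.blk (Dd U q.1 ∘ₗ (𝔬.G0 U ∘ₗ Dds U q.2))
    (fun (y y' : g.Site) => B₂ * Real.exp (-(δ₁ * g.dist y y')))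

/-- **THE PERTURBATION STEPS OF (3.130) ∕ (3.138) — THE HÖLDER PROBE MEMBERS AND THE DIRECTION-INDEXED MEMBERS** (p. 422's sentence and
p. 423's displayed pattern, θ = O(1)·Mα₀ in print: *"each operator Δ′_π provides the small factor α₀"*), block majorants θ·e^{−δ_K d}
between state classes: `pY β ∕ pY1 β ∕ pX β ∕ pX1 β` — the one-slot probe members (verbatim `…Classes.StepH.pY ∕ pY1 ∕ pX ∕ pX1`, constant
θ_H); and PER DIRECTION: `sDd ν ∕ sDd1 ν` — the derivative of the step through the component ∇_{U,ν}, ∇_{U,ν}G₀Δ′_π : 𝔠⁽²⁾ → 𝔠⁽¹⁾ and the same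
for Δ′_π + Δ⁽²⁾_π (constant θ_D; the species of `B9Thm312WholeLeft.LeftStep.stepD`); `pXd ν β ∕ pXd1 ν β` — its Hölder probe
Φ^X_β∘∇_{U,ν}∘G₀∘Δ′_π from 𝔠^{(−2)} into the probe class of weight (Lʲη)^{β−1} (constant θ_H; species of `StepH.pY`, p. 423's pattern for the
first factor); `tDd μ ε ∕ tDd1 μ ε` — the step applied to G₀∇\*_{U,μ} out of the input class, Δ′_πG₀∇\*_{U,μ} : `bHX ε` → 𝔠⁽¹⁾ (constant θ_H;
species of `StepH.tD`; p. 421's placement rule).  Their derivation from (3.131), (3.137), Theorems 3.1–3.3 and (3.49) is the located gap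
G-B9-16 (declared, not typed).  A HYPOTHESIS SCHEMA; nothing asserted.
[cite: Balaban1985BackgroundPropagators, (3.130)–(3.131) pp.421–422 + (3.137)–(3.138) p.423 + (3.42)–(3.45) p.398 + (3.39) p.397] -/
structure StepDir (𝔬 : Ops g B X Y Z W) (𝔭 : HolderProbes g B X Y PX PY) (Dd Dds : B.Cfg → P → Module.End ℝ (X → ℝ))
    (R₀ : ℝ) (H₀ : Prop) (bHX : ℝ → BlockNorm (toB6 g R₀ H₀) (X → ℝ)) (hlen : ∀ y : g.Site, 0 ≤ g.len y) (θD θH δK : ℝ)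
    (U : B.Cfg) : Prop where
  pY : ∀ β : ℝ, 0 ≤ β → β < 1 → HasMaj (cNormR R₀ H₀ 𝔬.blk hlen (-2)) (cNormR R₀ H₀ 𝔭.blkPY hlen (β - 1))
    ((𝔭.ΦY U β ∘ₗ 𝔬.D U ∘ₗ 𝔬.G0 U) ∘ₗ 𝔬.Tpi U) (fun a b => θH * Real.exp (-(δK * g.dist a b)))
  pY1 : ∀ β : ℝ, 0 ≤ β → β < 1 → HasMaj (cNormR R₀ H₀ 𝔬.blk hlen (-2)) (cNormR R₀ H₀ 𝔭.blkPY hlen (β - 1))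
    ((𝔭.ΦY U β ∘ₗ 𝔬.D U ∘ₗ 𝔬.G0 U) ∘ₗ (𝔬.Tpi U + 𝔬.T2 U)) (fun a b => θH * Real.exp (-(δK * g.dist a b)))
  pX : ∀ β : ℝ, 0 ≤ β → β < 1 → HasMaj (cNormR R₀ H₀ 𝔬.blk hlen (-1)) (cNormR R₀ H₀ 𝔭.blkPX hlen (β - 1))
    ((𝔭.ΦX U β ∘ₗ 𝔬.G0 U) ∘ₗ 𝔬.Tpi U) (fun a b => θH * Real.exp (-(δK * g.dist a b)))
  pX1 : ∀ β : ℝ, 0 ≤ β → β < 1 → HasMaj (cNormR R₀ H₀ 𝔬.blk hlen (-1)) (cNormR R₀ H₀ 𝔭.blkPX hlen (β - 1))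
    ((𝔭.ΦX U β ∘ₗ 𝔬.G0 U) ∘ₗ (𝔬.Tpi U + 𝔬.T2 U)) (fun a b => θH * Real.exp (-(δK * g.dist a b)))
  sDd : ∀ ν : P, HasMaj (cNorm R₀ H₀ 𝔬.blk hlen 2) (cNorm R₀ H₀ 𝔬.blk hlen 1) (Dd U ν ∘ₗ 𝔬.G0 U ∘ₗ 𝔬.Tpi U)
    (fun a b => θD * Real.exp (-(δK * g.dist a b)))
  sDd1 : ∀ ν : P, HasMaj (cNorm R₀ H₀ 𝔬.blk hlen 2) (cNorm R₀ H₀ 𝔬.blk hlen 1) (Dd U ν ∘ₗ 𝔬.G0 U ∘ₗ (𝔬.Tpi U + 𝔬.T2 U))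
    (fun a b => θD * Real.exp (-(δK * g.dist a b)))
  pXd : ∀ (ν : P) (β : ℝ), 0 ≤ β → β < 1 → HasMaj (cNormR R₀ H₀ 𝔬.blk hlen (-2)) (cNormR R₀ H₀ 𝔭.blkPX hlen (β - 1))
    ((𝔭.ΦX U β ∘ₗ Dd U ν ∘ₗ 𝔬.G0 U) ∘ₗ 𝔬.Tpi U) (fun a b => θH * Real.exp (-(δK * g.dist a b)))
  pXd1 : ∀ (ν : P) (β : ℝ), 0 ≤ β → β < 1 → HasMaj (cNormR R₀ H₀ 𝔬.blk hlen (-2)) (cNormR R₀ H₀ 𝔭.blkPX hlen (β - 1))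
    ((𝔭.ΦX U β ∘ₗ Dd U ν ∘ₗ 𝔬.G0 U) ∘ₗ (𝔬.Tpi U + 𝔬.T2 U)) (fun a b => θH * Real.exp (-(δK * g.dist a b)))
  tDd : ∀ (μ : P) (ε : ℝ), 0 < ε → HasMaj (bHX ε) (cNormR R₀ H₀ 𝔬.blk hlen 1) (𝔬.Tpi U ∘ₗ (𝔬.G0 U ∘ₗ Dds U μ))
    (fun a b => θH * Real.exp (-(δK * g.dist a b)))
  tDd1 : ∀ (μ : P) (ε : ℝ), 0 < ε → HasMaj (bHX ε) (cNormR R₀ H₀ 𝔬.blk hlen 1) ((𝔬.Tpi U + 𝔬.T2 U) ∘ₗ (𝔬.G0 U ∘ₗ Dds U μ))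
    (fun a b => θH * Real.exp (-(δK * g.dist a b)))

end Schemas

/-! ## §2 One member, one U: the mixed pair family of A ∈ {G, G₁} in the L² class and in the input classes -/

section OneMember

variable {g : B9.Geometry} {B : B9.Backgrounds} {X PX P : Type}
variable [Fintype X] [Fintype PX] [Fintype P] [Fintype g.Site]
variable {R₀ : ℝ} {H₀ : Prop}

omit [Fintype PX] [Fintype P] in
/-- ★ **(3.46), THE MIXED MEMBER FOR A ∈ {G, G₁} PER DIRECTION PAIR** — ‖1_{Δ(y)}∇_{U,ν}A∇\*_{U,μ}f‖₂ ≦ K₄e^{−ρd(y,y′)}‖f‖₂ for supp f ⊂ Δ(y′),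
K₄ = B₂ + B₂·θ·B₂(1 − B₂θc²)⁻¹·c²: r1-g6's kernel-checked Neumann bookkeeping `B9SectDL2Decay.thm312_entry_l2` with the letters E := ∇_{U,ν},
F := ∇\*_{U,μ} on the X-lattice (∇_νA∇\*_μ = ∇_νG₀∇\*_μ + (∇_νG₀)T′(A∇\*_μ), A∇\*_μ = G₀∇\*_μ + (G₀T′)(A∇\*_μ)) in the weight classes W₀ = W₃ = 1,
W₁ = W₁′ = Lʲη, W₂ = (Lʲη)⁻¹, from Theorem 3.3 (3.46) for G₀ — line 0 (`hl0`), the lines of ∇_νG₀ (`hl1`), G₀∇\*_μ (`hl2`) and ∇_νG₀∇\*_μ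
(`hl4`) — the step's L² bound (`hT`), the row sum (2.61) at σ with ρ + 2σ ≦ δ₁ and the smallness B₂θc² < 1 (the per-pair twin of
`…L2.l2bd_entry4_of_step`). [cite: Balaban1985BackgroundPropagators, Thm 3.12 p.423 + (3.46) p.398 + (3.39) p.397 + (3.130) p.421; Balaban1984PropagatorsII, Lemma 2.1 p.234] -/
theorem l2bd_mixed_of_step (hG : GeoOK g) {blk : X → g.Site} {G0 T A : Module.End ℝ (X → ℝ)} {E F : Module.End ℝ (X → ℝ)}
    {B₂ θ δ₁ ρ σ c : ℝ} (hrow : RowSum (toB6 g R₀ H₀) σ c)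
    (hB₂ : 0 ≤ B₂) (hθ : 0 ≤ θ) (hρ : 0 ≤ ρ) (hσ : 0 ≤ σ) (hρδ : ρ + 2 * σ ≤ δ₁)
    (hl0 : BlockBd (g := toB6 g R₀ H₀) blk blk G0 (fun (y y' : g.Site) => B₂ * g.len y * g.len y' * Real.exp (-(δ₁ * g.dist y y'))))
    (hl1 : BlockBd (g := toB6 g R₀ H₀) blk blk (E ∘ₗ G0) (fun (y y' : g.Site) => B₂ * g.len y' * Real.exp (-(δ₁ * g.dist y y'))))
    (hl2 : BlockBd (g := toB6 g R₀ H₀) blk blk (G0 ∘ₗ F) (fun (y y' : g.Site) => B₂ * g.len y * Real.exp (-(δ₁ * g.dist y y'))))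
    (hl4 : BlockBd (g := toB6 g R₀ H₀) blk blk (E ∘ₗ (G0 ∘ₗ F)) (fun (y y' : g.Site) => B₂ * Real.exp (-(δ₁ * g.dist y y'))))
    (hT : BlockBd (g := toB6 g R₀ H₀) blk blk T
      (fun (y y' : g.Site) => θ * (g.len y)⁻¹ * (g.len y')⁻¹ * Real.exp (-(δ₁ * g.dist y y'))))
    (hfix : A = G0 + G0 ∘ₗ T ∘ₗ A) (hq : B₂ * θ * c * c < 1) :
    BlockBd (g := toB6 g R₀ H₀) blk blk (E ∘ₗ (A ∘ₗ F))
      (fun (y y' : g.Site) => (B₂ + B₂ * (θ * (B₂ * (1 - B₂ * θ * c * c)⁻¹) * c) * c) * Real.exp (-(ρ * g.dist y y'))) := by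
  -- adapted from `B9Thm312WholeL2.l2bd_entry4_of_step` (∇_U ↦ ∇_{U,ν}, ∇\*_U ↦ ∇\*_{U,μ}, lattice Y ↦ X)
  have htri : Triangle254 (toB6 g R₀ H₀) := fun a b c => hG.tri a b c
  have hW1 : ∀ y : g.Site, 0 < (fun _ : g.Site => (1 : ℝ)) y := fun _ => one_pos
  have hWl : ∀ y : g.Site, 0 < g.len y := hG.lenpos
  have hWi : ∀ y : g.Site, 0 < (g.len y)⁻¹ := fun y => inv_pos.mpr (hG.lenpos y)
  have h := thm312_entry_l2 (g := toB6 g R₀ H₀) (blk₀ := blk) (blk := blk) (blk₃ := blk)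
    (W₀ := fun _ => (1 : ℝ)) (W₁ := fun y => g.len y) (W₂ := fun y => (g.len y)⁻¹) (W₁' := fun y => g.len y)
    (W₃ := fun _ => (1 : ℝ)) (G := A) (G0 := G0) (T' := T) (Eop := E) (Fop := F)
    (B := B₂) (θ := θ) (A := B₂) (θ' := θ) (BE := B₂) (AEF := B₂) hW1 hWl hWi hWl hW1 htri hG.dnn hrow hB₂ hθ hB₂ hθ hB₂ hB₂ hρ hσ
    hρδ
    (hl0.mono fun y y' => le_of_eq (by simp only [inv_inv, toB6_dist]; ring))
    (hT.mono fun y y' => le_of_eq (by simp only [toB6_dist]; ring))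
    (hl2.mono fun y y' => le_of_eq (by simp only [inv_inv, toB6_dist]; ring))
    (hT.mono fun y y' => le_of_eq (by simp only [toB6_dist]; ring))
    (hl1.mono fun y y' => le_of_eq (by simp only [inv_one, toB6_dist]; ring))
    (hl4.mono fun y y' => le_of_eq (by simp only [inv_one, toB6_dist]; ring))
    (fix_mul_of_fix hfix) hq
  refine h.mono fun y y' => le_of_eq ?_
  simp only [inv_one, one_mul, toB6_dist]

omit [Fintype PX] in
/-- ★ **(3.46)₃ OF THE RECORD (THE MIXED MEMBER) FOR A ∈ {G, G₁} AS THE PACKAGED PAIR FAMILY ∇_{U,ν}A∇\*_{U,μ}** — one model X → X × (P × P)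
with block map `blk ∘ Prod.fst` (n06-k's `familyOp`, the species of the v4 face's `hl3`), block bound √|P × P|·K₄·e^{−ρd(y,y′)}:
`l2bd_mixed_of_step` for every pair from the direction-indexed lines of `Thm33G0L2M`, then `blockBd_familyOp` ((3.39): *"max_{μ,ν}"* is
dominated by the packaged family). [cite: Balaban1985BackgroundPropagators, Thm 3.12 p.423 + (3.46) p.398 + (3.39) p.397; Balaban1984PropagatorsII, Lemma 2.1 p.234] -/
theorem l2bd_mixedFamily_of_step {Y Z W : Type} [Fintype Y] (hG : GeoOK g) {𝔬 : Ops g B X Y Z W}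
    {Dd Dds : B.Cfg → P → Module.End ℝ (X → ℝ)} {U : B.Cfg}
    {T A : Module.End ℝ (X → ℝ)} {B₂ θ δ₁ ρ σ c : ℝ} (hrow : RowSum (toB6 g R₀ H₀) σ c)
    (hB₂ : 0 ≤ B₂) (hθ : 0 ≤ θ) (hρ : 0 ≤ ρ) (hσ : 0 ≤ σ) (hρδ : ρ + 2 * σ ≤ δ₁)
    (hL : Thm33G0L2M 𝔬 Dd Dds R₀ H₀ B₂ δ₁ U)
    (hT : BlockBd (g := toB6 g R₀ H₀) 𝔬.blk 𝔬.blk T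
      (fun (y y' : g.Site) => θ * (g.len y)⁻¹ * (g.len y')⁻¹ * Real.exp (-(δ₁ * g.dist y y'))))
    (hfix : A = 𝔬.G0 U + 𝔬.G0 U ∘ₗ T ∘ₗ A) (hq : B₂ * θ * c * c < 1) :
    BlockBd (g := toB6 g R₀ H₀) 𝔬.blk (𝔬.blk ∘ Prod.fst) (familyOp (fun q : P × P => Dd U q.1 ∘ₗ (A ∘ₗ Dds U q.2)))
      (fun (y y' : g.Site) => Real.sqrt (Fintype.card (P × P)) * ((B₂ + B₂ * (θ * (B₂ * (1 - B₂ * θ * c * c)⁻¹) * c) * c) *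
        Real.exp (-(ρ * g.dist y y')))) := by
  have hc : 0 ≤ c ∨ IsEmpty g.Site := by
    by_cases hne : Nonempty g.Site
    · exact Or.inl (hrow.nonneg hne.some)
    · exact Or.inr (not_nonempty_iff.mp hne)
  rcases hc with hc | hemp
  swap
  · intro y' μ hμ y
    exact (hemp.false y).elim
  have hq1 : 0 ≤ (1 - B₂ * θ * c * c)⁻¹ := inv_nonneg.mpr (by linarith)
  have hK0 : 0 ≤ B₂ + B₂ * (θ * (B₂ * (1 - B₂ * θ * c * c)⁻¹) * c) * c :=
    add_nonneg hB₂ (mul_nonneg (mul_nonneg hB₂ (mul_nonneg (mul_nonneg hθ (mul_nonneg hB₂ hq1)) hc)) hc)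
  exact blockBd_familyOp (R := R₀) (H := H₀) 𝔬.blk 𝔬.blk
    (fun a b => mul_nonneg hK0 (Real.exp_nonneg _))
    fun q => l2bd_mixed_of_step hG hrow hB₂ hθ hρ hσ hρδ hL.l0 (hL.l1d q.1) (hL.l2d q.2) (hL.l4m q) hT hfix hq

omit [Fintype PX] in
/-- ★ **(3.44) FOR A ∈ {G, G₁} ON THE PACKAGED PAIR FAMILY** — ∇_{U,ν}A∇\*_{U,μ} = ∇_{U,ν}G₀∇\*_{U,μ} + (∇_{U,ν}A)(TG₀∇\*_{U,μ}) from the right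
form A = G₀ + ATG₀, per pair (`B9Thm312WholeHolder.input44_of_step` with the letters on the X-lattice: the per-direction left entry
∇_{U,ν}A of constant C₁ at the rate ρ — `h1d`, proved by `B9Thm312WholeLeft.entry1_of_stepD` from `Thm33G0Dir.e1d ∕ StepDir.sDd` upstream —
Theorem 3.3's (3.44) per pair `h44m`, the step out of the input class `htDd`), then packaged WITHOUT a |P| factor (`hasMaj_familyOp'`: sup
sizes): the family read from `bHX ε` into the sharp blocks of X × (P × P) (block map `blk ∘ Prod.fst`) has majorant (B_i(ε) +
C₁Λ·θ_H·c)·e^{−ρ₂d} for ρ₂ + σ ≦ (1 − α)ρ, ρ₂ ≦ δ_K, ρ₂ ≦ δ₀ — the input `h44` of n06-k's `lines3445_of_hasMaj_fam`.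
[cite: Balaban1985BackgroundPropagators, Thm 3.12 p.423 + (3.44) p.398 + (3.39) p.397 + (3.130) p.421 + p.422; Balaban1984PropagatorsII, Lemma 2.1 p.234] -/
theorem input44_family_of_step (hG : GeoOK g) {blk : X → g.Site} {bHε : BlockNorm (toB6 g R₀ H₀) (X → ℝ)}
    {G0 T A : Module.End ℝ (X → ℝ)} {Dd Dds : P → Module.End ℝ (X → ℝ)}
    {θH Bi C₁ δ₀ δK ρ ρ₂ α Λ σ c : ℝ} (hrow : RowSum (toB6 g R₀ H₀) σ c)
    (hθH : 0 ≤ θH) (hBi : 0 ≤ Bi) (hC₁ : 0 ≤ C₁) (hΛ : 0 ≤ Λ) (hρ₂ : 0 ≤ ρ₂) (hρ₂σ : ρ₂ + σ ≤ (1 - α) * ρ)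
    (hρ₂K : ρ₂ ≤ δK) (hρ₂δ : ρ₂ ≤ δ₀) (hST : ScaleTransfer g ρ α Λ (fun y => g.len y ^ (1 : ℝ)))
    (h1d : ∀ ν : P, HasMajorantHom (g := toB6 g R₀ H₀) blk blk (Dd ν ∘ₗ A)
      (fun a b => C₁ * g.len a * Real.exp (-(ρ * g.dist a b))))
    (h44m : ∀ q : P × P, HasMaj bHε (BlockNorm.ofBlocks (toB6 g R₀ H₀) blk) (Dd q.1 ∘ₗ (G0 ∘ₗ Dds q.2))
      (fun (a b : g.Site) => Bi * Real.exp (-(δ₀ * g.dist a b))))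
    (htDd : ∀ μ : P, HasMaj bHε (cNormR R₀ H₀ blk hG.lenle 1) (T ∘ₗ (G0 ∘ₗ Dds μ))
      (fun a b => θH * Real.exp (-(δK * g.dist a b))))
    (hfixR : A = G0 + A ∘ₗ T ∘ₗ G0) :
    HasMaj bHε (BlockNorm.ofBlocks (toB6 g R₀ H₀) (blk ∘ Prod.fst))
      (familyOp (fun q : P × P => Dd q.1 ∘ₗ (A ∘ₗ Dds q.2)))
      (fun (a b : g.Site) => (Bi + C₁ * Λ * θH * c) * Real.exp (-(ρ₂ * g.dist a b))) := by
  have hc : 0 ≤ c ∨ IsEmpty g.Site := by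
    by_cases hne : Nonempty g.Site
    · exact Or.inl (hrow.nonneg hne.some)
    · exact Or.inr (not_nonempty_iff.mp hne)
  rcases hc with hc | hemp
  swap
  · intro y' μ hμ y
    exact (hemp.false y).elim
  have hK0 : 0 ≤ Bi + C₁ * Λ * θH * c := add_nonneg hBi (mul_nonneg (mul_nonneg (mul_nonneg hC₁ hΛ) hθH) hc)
  exact hasMaj_familyOp' (R := R₀) (H := H₀) blk (fun a b => mul_nonneg hK0 (Real.exp_nonneg _))
    fun q => input44_of_step hG hrow hθH hBi hC₁ hΛ hρ₂ hρ₂σ hρ₂K hρ₂δ hST (h1d q.1) (h44m q) (htDd q.2) hfixR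

omit [Fintype P] in
/-- The weighted Φ^X_β-probe majorant of the per-direction left entry ∇_{U,ν}A: Φ^X_β∘∇_ν∘A = Φ^X_β∘∇_ν∘G₀ + (Φ^X_β∘∇_νG₀T)∘A from A = G₀ +
G₀TA (`B9Thm312WholeHolder.probe43L_cNormR` with E := Φ^X_β∘∇_{U,ν}): majorant (B_h + θ_H·B₀(1 − θc)⁻¹·c)·e^{−ρd} from 𝔠^{(0)} into 𝔠_P^{(β−1)}.
[cite: Balaban1985BackgroundPropagators, Thm 3.12 p.423 + (3.43) p.398 + (3.130) p.421 + p.423; Balaban1984PropagatorsII, Lemma 2.1 p.234] -/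
theorem probe43d_cNormR (hG : GeoOK g) {blk : X → g.Site} {blkP : PX → g.Site} {G0 T A Dν : Module.End ℝ (X → ℝ)}
    {Φ : (X → ℝ) →ₗ[ℝ] (PX → ℝ)} {θ θH B₀ Bh β δ₀ δK ρ σ c : ℝ} (hrow : RowSum (toB6 g R₀ H₀) σ c)
    (hθ : 0 ≤ θ) (hθH : 0 ≤ θH) (hB₀ : 0 ≤ B₀) (hBh : 0 ≤ Bh) (hρ : 0 ≤ ρ) (hρS : ρ ≤ δ₀) (hρδ : ρ + σ ≤ δK)
    (hK : HasMaj (cNorm R₀ H₀ blk hG.lenle 2) (cNorm R₀ H₀ blk hG.lenle 2) (G0 ∘ₗ T)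
      (fun a b => θ * Real.exp (-(δK * g.dist a b))))
    (he0 : HasMajorant (g := toB6 g R₀ H₀) blk G0 (fun a b => B₀ * g.len a ^ 2 * Real.exp (-(δ₀ * g.dist a b))))
    (h43 : HasMajorantHom (g := toB6 g R₀ H₀) blk blkP (Φ ∘ₗ (Dν ∘ₗ G0))
      (fun (a b : g.Site) => Bh * g.len a ^ (1 - β) * Real.exp (-(δ₀ * g.dist a b))))
    (hP : HasMaj (cNormR R₀ H₀ blk hG.lenle (-2)) (cNormR R₀ H₀ blkP hG.lenle (β - 1))
      ((Φ ∘ₗ Dν ∘ₗ G0) ∘ₗ T) (fun a b => θH * Real.exp (-(δK * g.dist a b))))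
    (hfix : A = G0 + G0 ∘ₗ T ∘ₗ A) (hq : θ * c < 1) :
    HasMaj (cNormR R₀ H₀ blk hG.lenle 0) (cNormR R₀ H₀ blkP hG.lenle (β - 1)) ((Φ ∘ₗ Dν) ∘ₗ A)
      (fun a b => (Bh + θH * (B₀ * (1 - θ * c)⁻¹) * c) * Real.exp (-(ρ * g.dist a b))) := by
  have h43' : HasMajorantHom (g := toB6 g R₀ H₀) blk blkP ((Φ ∘ₗ Dν) ∘ₗ G0)
      (fun (a b : g.Site) => Bh * g.len a ^ (1 - β) * Real.exp (-(δ₀ * g.dist a b))) := h43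
  have hP' : HasMaj (cNormR R₀ H₀ blk hG.lenle (-2)) (cNormR R₀ H₀ blkP hG.lenle (β - 1))
      (((Φ ∘ₗ Dν) ∘ₗ G0) ∘ₗ T) (fun a b => θH * Real.exp (-(δK * g.dist a b))) := hP
  exact probe43L_cNormR hG hrow hθ hθH hB₀ hBh hρ hρS hρδ hK he0 h43' hP' hfix hq

/-- ★ **(3.45) FOR A ∈ {G, G₁} ON THE PACKAGED PAIR FAMILY, PROBES SLICED** — Φ^X_β∘∇_{U,ν}A∇\*_{U,μ} = Φ^X_β∘∇_νG₀∇\*_μ + (Φ^X_β∘∇_νA)(TG₀∇\*_μ)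
from the right form, per pair (`B9Thm312WholeHolder.input45_of_step` with E := Φ^X_β∘∇_{U,ν}, F := ∇\*_{U,μ}: the weighted probe majorant of
the per-direction left entry `probe43d_cNormR`, Theorem 3.3's (3.45) per pair `h45m`, the step out of `bHX (β+ε)` `htDd`), then the
probes sliced over the family (`sliceProbe_comp_familyOp`) and packaged without a |P| factor (`hasMaj_familyOp'`): `sliceProbe Φ^X_β ∘
familyOp (q ↦ ∇_{q.1}A∇\*_{q.2})` read from `bHX (β+ε)` into the probe blocks (block map `blkPX ∘ Prod.fst`) has majorant (B_i2 +
C_hΛ·θ_H·c)·(Lʲη)^{−β}·e^{−ρ₂d}, C_h = B_h + θ_H·B₀(1 − θc)⁻¹·c — the input `h45` of n06-k's `lines3445_of_hasMaj_fam`.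
[cite: Balaban1985BackgroundPropagators, Thm 3.12 p.423 + (3.45) p.398 + (3.39)–(3.40) p.397 + (3.130) p.421 + p.423; Balaban1984PropagatorsII, Lemma 2.1 p.234] -/
theorem input45_family_of_step (hG : GeoOK g) {blk : X → g.Site} {blkP : PX → g.Site} {bHε : BlockNorm (toB6 g R₀ H₀) (X → ℝ)}
    {G0 T A : Module.End ℝ (X → ℝ)} {Dd Dds : P → Module.End ℝ (X → ℝ)} {Φ : (X → ℝ) →ₗ[ℝ] (PX → ℝ)}
    {θ θH B₀ Bh Bi2 β δ₀ δK ρ ρ₂ α Λ σ c : ℝ} (hrow : RowSum (toB6 g R₀ H₀) σ c)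
    (hθ : 0 ≤ θ) (hθH : 0 ≤ θH) (hB₀ : 0 ≤ B₀) (hBh : 0 ≤ Bh) (hBi2 : 0 ≤ Bi2) (hΛ : 0 ≤ Λ)
    (hρ : 0 ≤ ρ) (hρS : ρ ≤ δ₀) (hρδ : ρ + σ ≤ δK) (hρ₂ : 0 ≤ ρ₂) (hρ₂σ : ρ₂ + σ ≤ (1 - α) * ρ)
    (hρ₂K : ρ₂ ≤ δK) (hρ₂δ : ρ₂ ≤ δ₀) (hST : ScaleTransfer g ρ α Λ (fun y => g.len y ^ (1 : ℝ)))
    (hK : HasMaj (cNorm R₀ H₀ blk hG.lenle 2) (cNorm R₀ H₀ blk hG.lenle 2) (G0 ∘ₗ T)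
      (fun a b => θ * Real.exp (-(δK * g.dist a b))))
    (he0 : HasMajorant (g := toB6 g R₀ H₀) blk G0 (fun a b => B₀ * g.len a ^ 2 * Real.exp (-(δ₀ * g.dist a b))))
    (h43d : ∀ ν : P, HasMajorantHom (g := toB6 g R₀ H₀) blk blkP (Φ ∘ₗ (Dd ν ∘ₗ G0))
      (fun (a b : g.Site) => Bh * g.len a ^ (1 - β) * Real.exp (-(δ₀ * g.dist a b))))
    (hpXd : ∀ ν : P, HasMaj (cNormR R₀ H₀ blk hG.lenle (-2)) (cNormR R₀ H₀ blkP hG.lenle (β - 1))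
      ((Φ ∘ₗ Dd ν ∘ₗ G0) ∘ₗ T) (fun a b => θH * Real.exp (-(δK * g.dist a b))))
    (h45m : ∀ q : P × P, HasMaj bHε (BlockNorm.ofBlocks (toB6 g R₀ H₀) blkP) (Φ ∘ₗ (Dd q.1 ∘ₗ (G0 ∘ₗ Dds q.2)))
      (fun (a b : g.Site) => Bi2 * g.len a ^ (-β) * Real.exp (-(δ₀ * g.dist a b))))
    (htDd : ∀ μ : P, HasMaj bHε (cNormR R₀ H₀ blk hG.lenle 1) (T ∘ₗ (G0 ∘ₗ Dds μ))
      (fun a b => θH * Real.exp (-(δK * g.dist a b))))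
    (hfix : A = G0 + G0 ∘ₗ T ∘ₗ A) (hfixR : A = G0 + A ∘ₗ T ∘ₗ G0) (hq : θ * c < 1) :
    HasMaj bHε (BlockNorm.ofBlocks (toB6 g R₀ H₀) (blkP ∘ Prod.fst))
      (sliceProbe Φ ∘ₗ familyOp (fun q : P × P => Dd q.1 ∘ₗ (A ∘ₗ Dds q.2)))
      (fun (a b : g.Site) => (Bi2 + (Bh + θH * (B₀ * (1 - θ * c)⁻¹) * c) * Λ * θH * c) * g.len a ^ (-β) *
        Real.exp (-(ρ₂ * g.dist a b))) := by
  have hc : 0 ≤ c ∨ IsEmpty g.Site := by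
    by_cases hne : Nonempty g.Site
    · exact Or.inl (hrow.nonneg hne.some)
    · exact Or.inr (not_nonempty_iff.mp hne)
  rcases hc with hc | hemp
  swap
  · intro y' μ hμ y
    exact (hemp.false y).elim
  have hq1 : 0 ≤ (1 - θ * c)⁻¹ := inv_nonneg.mpr (by linarith)
  have hCh : 0 ≤ Bh + θH * (B₀ * (1 - θ * c)⁻¹) * c := add_nonneg hBh (mul_nonneg (mul_nonneg hθH (mul_nonneg hB₀ hq1)) hc)
  have hK0 : 0 ≤ Bi2 + (Bh + θH * (B₀ * (1 - θ * c)⁻¹) * c) * Λ * θH * c :=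
    add_nonneg hBi2 (mul_nonneg (mul_nonneg (mul_nonneg hCh hΛ) hθH) hc)
  rw [sliceProbe_comp_familyOp]
  refine hasMaj_familyOp' (R := R₀) (H := H₀) blkP
    (fun a b => mul_nonneg (mul_nonneg hK0 (Real.rpow_nonneg (hG.lenle a) _)) (Real.exp_nonneg _)) fun q => ?_
  have h43A := probe43d_cNormR hG hrow hθ hθH hB₀ hBh hρ hρS hρδ hK he0 (h43d q.1) (hpXd q.1) hfix hq
  have h45' : HasMaj bHε (BlockNorm.ofBlocks (toB6 g R₀ H₀) blkP) ((Φ ∘ₗ Dd q.1) ∘ₗ (G0 ∘ₗ Dds q.2))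
      (fun (a b : g.Site) => Bi2 * g.len a ^ (-β) * Real.exp (-(δ₀ * g.dist a b))) := h45m q
  have h := input45_of_step hG hrow hθH hBi2 hCh hΛ hρ₂ hρ₂σ hρ₂K hρ₂δ hST h43A h45' (htDd q.2) hfixR
  exact h.congr fun μ => rfl

end OneMember

end

end Literature.MathematicalPhysics.QuantumFieldTheory.Balaban1983to89.B9Thm312WholeDir
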